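import Mathlib
import Summits.MatrixMultiplication.MatrixMultiplication.Theorems.SnSubsetDichotomyHyperoctahedralThresholdCleanPairHop
import Summits.MatrixMultiplication.MatrixMultiplication.Theorems.SnSubsetDichotomyHyperoctahedralThresholdRootTypicalSum

/-!
# Clean-pair atom — budgeted iteration: no totally dirty dense level

Helper for crux `SnSubsetDichotomy.HyperoctahedralThreshold` (stmt-MatrixMultiplication-10883), line
`Lines/stub_plan_poorRigidCore.md`, proof plan `work/ATOM_PROOF.md` §5 of the stub-plan prover seat.

* `card_level_le`: `|S| ≤ 3·2^d`.
* `no_level`, `no_start_level`: with the potential `|S|·2^(a-d)` (cheap hops triple it, big hops multiply it by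
  `√s₀/(64(a+1)²)`, and always `≤ 3·2^a`) at most `C` cheap and `B` big hops fit; cheap hops consume `≤ t₁` depth and big hops
  halve it, so `a ≥ 2^B(dmin + C t₁)` keeps the depth `≥ dmin`, hence `|S| ≥ 2`, and the hop applies again — contradiction.
-/

-- the tree's namespace `Summit.MatrixMultiplication.MatrixMultiplication.…` repeats a component by design
set_option linter.dupNamespace false

namespace Summit.MatrixMultiplication.MatrixMultiplication.Theorems.HyperoctahedralThreshold

namespace CleanPair

open TwinSupplyCS

variable {n : ℕ}

section Main

variable {μ : Fin 3 → Equiv.Perm (Fin n)} {F : Finset (Fin n)} {r : ℕ}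


/-- A level's members are distinct reduced words of its depth, so `|S| ≤ 3 · 2^d`. -/
theorem card_level_le {p : Bool → Fin n} {d : ℕ} {S : Finset (List (Fin 3))} (hI : Inv μ F r p d S) :
    S.card ≤ 3 * 2 ^ d := by
  obtain ⟨_, hmem, _, _⟩ := hI
  have hsub : S ⊆ RW d := fun β hβ => mem_RW.2 ⟨(hmem β hβ).1, (hmem β hβ).2.1⟩
  exact (Finset.card_le_card hsub).trans (RootTypicalSum.card_RW_le d)

/-- **Budgeted iteration.**  With the potential `Dens = |S|·2^(a-d)` (cheap hops triple it, big hops multiply it by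
`√s₀/(64(a+1)²) ≥ 1`, and always `Dens ≤ 3·2^a`), at most `C` cheap and `B` big hops fit; cheap hops consume `≤ t₁` depth
and big hops halve it, so with `a ≥ 2^B (dmin + C t₁)` the depth never drops below `dmin`, which keeps `|S| ≥ 2` and the
hop applicable — a contradiction after `B + C + 1` hops.  Stated as: no level with the counters' invariant exists. -/
theorem no_level (hμ : ∀ c, μ c * μ c = 1) (hF : NoShortCycleOutside μ F r) {s₀ a B C dmin t₁ D₀ : ℕ}
    (hs₀ : 0 < s₀) (hdense : ∀ y ∉ F, ∀ m, 1 ≤ m → m ≤ 2 * a → s₀ * (closedAt μ m y).card ≤ 2 ^ m)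
    (hr : 288 * (a + 1) ^ 2 ≤ 2 ^ (r / 2)) (ht₁ : 3 * s₀ < 2 ^ (t₁ + 1)) (hΛ : 64 * (a + 1) ^ 2 ≤ Nat.sqrt s₀)
    (hC : 3 * 2 ^ a < D₀ * 3 ^ (C + 1))
    (hB : 3 * 2 ^ a * (64 * (a + 1) ^ 2) ^ (B + 1) < D₀ * Nat.sqrt s₀ ^ (B + 1))
    (hdepth : 2 ^ B * (dmin + C * t₁) ≤ a) (hD₀ : 2 ^ (a - dmin + 1) ≤ D₀) (hdmin : dmin ≤ a) :
    ∀ (fuel b c : ℕ) (p : Bool → Fin n) (d : ℕ) (S : Finset (List (Fin 3))), Inv μ F r p d S → d ≤ a →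
      D₀ * 3 ^ c * Nat.sqrt s₀ ^ b ≤ S.card * 2 ^ (a - d) * (64 * (a + 1) ^ 2) ^ b →
      a ≤ d * 2 ^ b + c * t₁ * 2 ^ b → b + c + fuel = B + C + 1 → False := by
  intro fuel
  induction fuel with
  | zero =>
    intro b c p d S hI hda hpot hdep hfuel
    -- both counters are capped by the potential, so b + c ≤ B + C
    have hcard := card_level_le hI
    have hDens : S.card * 2 ^ (a - d) ≤ 3 * 2 ^ a := by
      calc S.card * 2 ^ (a - d) ≤ 3 * 2 ^ d * 2 ^ (a - d) := Nat.mul_le_mul_right _ hcard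
        _ = 3 * 2 ^ a := by rw [mul_assoc, ← pow_add, Nat.add_sub_cancel' hda]
    have h64 : ∀ e, (64 * (a + 1) ^ 2) ^ e ≤ Nat.sqrt s₀ ^ e := fun e => Nat.pow_le_pow_left hΛ e
    have hcC : c ≤ C := by
      by_contra hc
      push Not at hc
      have h1 : D₀ * 3 ^ (C + 1) * Nat.sqrt s₀ ^ b ≤ 3 * 2 ^ a * (64 * (a + 1) ^ 2) ^ b :=
        calc D₀ * 3 ^ (C + 1) * Nat.sqrt s₀ ^ b ≤ D₀ * 3 ^ c * Nat.sqrt s₀ ^ b := by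
              gcongr; norm_num; omega
          _ ≤ S.card * 2 ^ (a - d) * (64 * (a + 1) ^ 2) ^ b := hpot
          _ ≤ 3 * 2 ^ a * (64 * (a + 1) ^ 2) ^ b := Nat.mul_le_mul_right _ hDens
      have h2 : 3 * 2 ^ a * (64 * (a + 1) ^ 2) ^ b < D₀ * 3 ^ (C + 1) * Nat.sqrt s₀ ^ b :=
        calc 3 * 2 ^ a * (64 * (a + 1) ^ 2) ^ b ≤ 3 * 2 ^ a * Nat.sqrt s₀ ^ b := Nat.mul_le_mul_left _ (h64 b)
          _ < D₀ * 3 ^ (C + 1) * Nat.sqrt s₀ ^ b :=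
            Nat.mul_lt_mul_of_pos_right hC (by positivity)
      omega
    have hbB : b ≤ B := by
      by_contra hb
      push Not at hb
      obtain ⟨e, rfl⟩ : ∃ e, b = B + 1 + e := ⟨b - (B + 1), by omega⟩
      have h1 : D₀ * Nat.sqrt s₀ ^ (B + 1 + e) ≤ 3 * 2 ^ a * (64 * (a + 1) ^ 2) ^ (B + 1 + e) :=
        calc D₀ * Nat.sqrt s₀ ^ (B + 1 + e) ≤ D₀ * 3 ^ c * Nat.sqrt s₀ ^ (B + 1 + e) :=
              Nat.mul_le_mul_right _ (Nat.le_mul_of_pos_right _ (by positivity))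
          _ ≤ S.card * 2 ^ (a - d) * (64 * (a + 1) ^ 2) ^ (B + 1 + e) := hpot
          _ ≤ 3 * 2 ^ a * (64 * (a + 1) ^ 2) ^ (B + 1 + e) := Nat.mul_le_mul_right _ hDens
      have h2 : 3 * 2 ^ a * (64 * (a + 1) ^ 2) ^ (B + 1 + e) < D₀ * Nat.sqrt s₀ ^ (B + 1 + e) :=
        calc 3 * 2 ^ a * (64 * (a + 1) ^ 2) ^ (B + 1 + e)
            = 3 * 2 ^ a * (64 * (a + 1) ^ 2) ^ (B + 1) * (64 * (a + 1) ^ 2) ^ e := by rw [pow_add]; ring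
          _ ≤ 3 * 2 ^ a * (64 * (a + 1) ^ 2) ^ (B + 1) * Nat.sqrt s₀ ^ e := Nat.mul_le_mul_left _ (h64 e)
          _ < D₀ * Nat.sqrt s₀ ^ (B + 1) * Nat.sqrt s₀ ^ e :=
              Nat.mul_lt_mul_of_pos_right hB (by positivity)
          _ = D₀ * Nat.sqrt s₀ ^ (B + 1 + e) := by rw [pow_add]; ring
      omega
    omega
  | succ fuel ih =>
    intro b c p d S hI hda hpot hdep hfuel
    have hcard := card_level_le hI
    have hDens : S.card * 2 ^ (a - d) ≤ 3 * 2 ^ a := by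
      calc S.card * 2 ^ (a - d) ≤ 3 * 2 ^ d * 2 ^ (a - d) := Nat.mul_le_mul_right _ hcard
        _ = 3 * 2 ^ a := by rw [mul_assoc, ← pow_add, Nat.add_sub_cancel' hda]
    have h64 : ∀ e, (64 * (a + 1) ^ 2) ^ e ≤ Nat.sqrt s₀ ^ e := fun e => Nat.pow_le_pow_left hΛ e
    -- counters capped (same computation as in the base case)
    have hcC : c ≤ C := by
      by_contra hc
      push Not at hc
      have h1 : D₀ * 3 ^ (C + 1) * Nat.sqrt s₀ ^ b ≤ 3 * 2 ^ a * (64 * (a + 1) ^ 2) ^ b :=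
        calc D₀ * 3 ^ (C + 1) * Nat.sqrt s₀ ^ b ≤ D₀ * 3 ^ c * Nat.sqrt s₀ ^ b := by
              gcongr; norm_num; omega
          _ ≤ S.card * 2 ^ (a - d) * (64 * (a + 1) ^ 2) ^ b := hpot
          _ ≤ 3 * 2 ^ a * (64 * (a + 1) ^ 2) ^ b := Nat.mul_le_mul_right _ hDens
      have h2 : 3 * 2 ^ a * (64 * (a + 1) ^ 2) ^ b < D₀ * 3 ^ (C + 1) * Nat.sqrt s₀ ^ b :=
        calc 3 * 2 ^ a * (64 * (a + 1) ^ 2) ^ b ≤ 3 * 2 ^ a * Nat.sqrt s₀ ^ b := Nat.mul_le_mul_left _ (h64 b)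
          _ < D₀ * 3 ^ (C + 1) * Nat.sqrt s₀ ^ b :=
            Nat.mul_lt_mul_of_pos_right hC (by positivity)
      omega
    have hbB : b ≤ B := by
      by_contra hb
      push Not at hb
      obtain ⟨e, rfl⟩ : ∃ e, b = B + 1 + e := ⟨b - (B + 1), by omega⟩
      have h1 : D₀ * Nat.sqrt s₀ ^ (B + 1 + e) ≤ 3 * 2 ^ a * (64 * (a + 1) ^ 2) ^ (B + 1 + e) :=
        calc D₀ * Nat.sqrt s₀ ^ (B + 1 + e) ≤ D₀ * 3 ^ c * Nat.sqrt s₀ ^ (B + 1 + e) :=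
              Nat.mul_le_mul_right _ (Nat.le_mul_of_pos_right _ (by positivity))
          _ ≤ S.card * 2 ^ (a - d) * (64 * (a + 1) ^ 2) ^ (B + 1 + e) := hpot
          _ ≤ 3 * 2 ^ a * (64 * (a + 1) ^ 2) ^ (B + 1 + e) := Nat.mul_le_mul_right _ hDens
      have h2 : 3 * 2 ^ a * (64 * (a + 1) ^ 2) ^ (B + 1 + e) < D₀ * Nat.sqrt s₀ ^ (B + 1 + e) :=
        calc 3 * 2 ^ a * (64 * (a + 1) ^ 2) ^ (B + 1 + e)
            = 3 * 2 ^ a * (64 * (a + 1) ^ 2) ^ (B + 1) * (64 * (a + 1) ^ 2) ^ e := by rw [pow_add]; ring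
          _ ≤ 3 * 2 ^ a * (64 * (a + 1) ^ 2) ^ (B + 1) * Nat.sqrt s₀ ^ e := Nat.mul_le_mul_left _ (h64 e)
          _ < D₀ * Nat.sqrt s₀ ^ (B + 1) * Nat.sqrt s₀ ^ e :=
              Nat.mul_lt_mul_of_pos_right hB (by positivity)
          _ = D₀ * Nat.sqrt s₀ ^ (B + 1 + e) := by rw [pow_add]; ring
      omega
    -- depth stays above dmin
    have hdmin' : dmin ≤ d := by
      have h1 : 2 ^ b ≤ 2 ^ B := Nat.pow_le_pow_right (by norm_num) hbB
      have h2 : c * t₁ * 2 ^ b ≤ C * t₁ * 2 ^ B := by gcongr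
      have h3 : 2 ^ B * dmin + C * t₁ * 2 ^ B ≤ d * 2 ^ b + c * t₁ * 2 ^ b := by
        calc 2 ^ B * dmin + C * t₁ * 2 ^ B = 2 ^ B * (dmin + C * t₁) := by ring
          _ ≤ a := hdepth
          _ ≤ d * 2 ^ b + c * t₁ * 2 ^ b := hdep
      have h4 : 2 ^ B * dmin ≤ d * 2 ^ b := by omega
      have h5 : 2 ^ b * dmin ≤ 2 ^ B * dmin := Nat.mul_le_mul_right _ h1
      have h6 : 2 ^ b * dmin ≤ 2 ^ b * d := by rw [Nat.mul_comm d] at h4; exact h5.trans h4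
      exact Nat.le_of_mul_le_mul_left h6 (by positivity)
    -- hence at least two members
    have hM : 2 ≤ S.card := by
      have h1 : D₀ ≤ S.card * 2 ^ (a - d) := by
        have h2 : D₀ * (64 * (a + 1) ^ 2) ^ b ≤ D₀ * 3 ^ c * Nat.sqrt s₀ ^ b := by
          calc D₀ * (64 * (a + 1) ^ 2) ^ b ≤ D₀ * Nat.sqrt s₀ ^ b := Nat.mul_le_mul_left _ (h64 b)
            _ ≤ D₀ * 3 ^ c * Nat.sqrt s₀ ^ b := Nat.mul_le_mul_right _ (Nat.le_mul_of_pos_right _ (by positivity))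
        exact Nat.le_of_mul_le_mul_right (h2.trans hpot) (by positivity)
      have h3 : 2 ^ (a - d) * 2 ≤ 2 ^ (a - dmin + 1) := by
        rw [← pow_succ]; exact Nat.pow_le_pow_right (by norm_num) (by omega)
      have h4 : 2 * 2 ^ (a - d) ≤ S.card * 2 ^ (a - d) := by
        calc 2 * 2 ^ (a - d) = 2 ^ (a - d) * 2 := by ring
          _ ≤ D₀ := h3.trans hD₀
          _ ≤ S.card * 2 ^ (a - d) := h1
      exact Nat.le_of_mul_le_mul_right h4 (by positivity)
    -- hop
    obtain ⟨p', d', S', hI', hgap, h2d, hd'd, hgain⟩ := hop hμ hF hI hs₀ hda hdense hr hM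
    have hda' : d' ≤ a := hd'd.trans hda
    have e2 : 2 ^ (a - d') = 2 ^ (d - d') * 2 ^ (a - d) := by rw [← pow_add]; congr 1; omega
    rcases hgain with ⟨hc1, hc2⟩ | hb
    · -- cheap hop: c ↦ c + 1
      have hcons : d - d' ≤ t₁ := by
        have : 2 ^ (d - d' + 1) < 2 ^ (t₁ + 1) := lt_of_le_of_lt hc1 ht₁
        have := (Nat.pow_lt_pow_iff_right (by norm_num : 1 < 2)).1 this
        omega
      refine ih b (c + 1) p' d' S' hI' hda' ?_ ?_ (by omega)
      · -- potential
        have h1 : 3 * (S.card * 2 ^ (a - d)) ≤ S'.card * 2 ^ (a - d') := by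
          have h2 : 3 * S.card * 2 ^ d' * 2 ^ (a - d) ≤ S'.card * 2 ^ d * 2 ^ (a - d) :=
            Nat.mul_le_mul_right _ hc2
          have h3 : 2 ^ d * 2 ^ (a - d) = 2 ^ d' * 2 ^ (a - d') := by
            rw [← pow_add, ← pow_add]; congr 1; omega
          have h4 : 3 * (S.card * 2 ^ (a - d)) * 2 ^ d' ≤ S'.card * 2 ^ (a - d') * 2 ^ d' := by
            calc 3 * (S.card * 2 ^ (a - d)) * 2 ^ d' = 3 * S.card * 2 ^ d' * 2 ^ (a - d) := by ring
              _ ≤ S'.card * 2 ^ d * 2 ^ (a - d) := h2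
              _ = S'.card * 2 ^ (a - d') * 2 ^ d' := by rw [mul_assoc, h3]; ring
          exact Nat.le_of_mul_le_mul_right h4 (by positivity)
        calc D₀ * 3 ^ (c + 1) * Nat.sqrt s₀ ^ b = 3 * (D₀ * 3 ^ c * Nat.sqrt s₀ ^ b) := by rw [pow_succ]; ring
          _ ≤ 3 * (S.card * 2 ^ (a - d) * (64 * (a + 1) ^ 2) ^ b) := Nat.mul_le_mul_left _ hpot
          _ = 3 * (S.card * 2 ^ (a - d)) * (64 * (a + 1) ^ 2) ^ b := by ring
          _ ≤ S'.card * 2 ^ (a - d') * (64 * (a + 1) ^ 2) ^ b := Nat.mul_le_mul_right _ h1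
      · -- depth
        have : d * 2 ^ b ≤ d' * 2 ^ b + t₁ * 2 ^ b := by
          rw [← Nat.add_mul]; exact Nat.mul_le_mul_right _ (by omega)
        calc a ≤ d * 2 ^ b + c * t₁ * 2 ^ b := hdep
          _ ≤ d' * 2 ^ b + t₁ * 2 ^ b + c * t₁ * 2 ^ b := Nat.add_le_add_right this _
          _ = d' * 2 ^ b + (c + 1) * t₁ * 2 ^ b := by ring
    · -- big hop: b ↦ b + 1
      refine ih (b + 1) c p' d' S' hI' hda' ?_ ?_ (by omega)
      · -- potential
        have h1 : S.card * 2 ^ (a - d) * Nat.sqrt s₀ ≤ S'.card * 2 ^ (a - d') * (64 * (a + 1) ^ 2) := by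
          have h2 : S.card * Nat.sqrt s₀ * 2 ^ d' * 2 ^ (a - d) ≤ S'.card * 2 ^ d * (64 * (a + 1) ^ 2) * 2 ^ (a - d) :=
            Nat.mul_le_mul_right _ hb
          have h3 : 2 ^ d * 2 ^ (a - d) = 2 ^ d' * 2 ^ (a - d') := by
            rw [← pow_add, ← pow_add]; congr 1; omega
          have h4 : S.card * 2 ^ (a - d) * Nat.sqrt s₀ * 2 ^ d' ≤ S'.card * 2 ^ (a - d') * (64 * (a + 1) ^ 2) * 2 ^ d' := by
            calc S.card * 2 ^ (a - d) * Nat.sqrt s₀ * 2 ^ d' = S.card * Nat.sqrt s₀ * 2 ^ d' * 2 ^ (a - d) := by ring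
              _ ≤ S'.card * 2 ^ d * (64 * (a + 1) ^ 2) * 2 ^ (a - d) := h2
              _ = S'.card * (64 * (a + 1) ^ 2) * (2 ^ d * 2 ^ (a - d)) := by ring
              _ = S'.card * 2 ^ (a - d') * (64 * (a + 1) ^ 2) * 2 ^ d' := by rw [h3]; ring
          exact Nat.le_of_mul_le_mul_right h4 (by positivity)
        calc D₀ * 3 ^ c * Nat.sqrt s₀ ^ (b + 1) = D₀ * 3 ^ c * Nat.sqrt s₀ ^ b * Nat.sqrt s₀ := by rw [pow_succ]; ring
          _ ≤ S.card * 2 ^ (a - d) * (64 * (a + 1) ^ 2) ^ b * Nat.sqrt s₀ := Nat.mul_le_mul_right _ hpot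
          _ = S.card * 2 ^ (a - d) * Nat.sqrt s₀ * (64 * (a + 1) ^ 2) ^ b := by ring
          _ ≤ S'.card * 2 ^ (a - d') * (64 * (a + 1) ^ 2) * (64 * (a + 1) ^ 2) ^ b := Nat.mul_le_mul_right _ h1
          _ = S'.card * 2 ^ (a - d') * (64 * (a + 1) ^ 2) ^ (b + 1) := by rw [pow_succ]; ring
      · -- depth
        calc a ≤ d * 2 ^ b + c * t₁ * 2 ^ b := hdep
          _ ≤ 2 * d' * 2 ^ b + 2 * (c * t₁ * 2 ^ b) := by
              have := Nat.mul_le_mul_right (2 ^ b) h2d; omega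
          _ = d' * 2 ^ (b + 1) + c * t₁ * 2 ^ (b + 1) := by rw [pow_succ]; ring

/-- **No totally dirty dense level.**  The start level (`d = a`, `b = c = 0`) cannot exist. -/
theorem no_start_level (hμ : ∀ c, μ c * μ c = 1) (hF : NoShortCycleOutside μ F r) {s₀ a B C dmin t₁ D₀ : ℕ}
    (hs₀ : 0 < s₀) (hdense : ∀ y ∉ F, ∀ m, 1 ≤ m → m ≤ 2 * a → s₀ * (closedAt μ m y).card ≤ 2 ^ m)
    (hr : 288 * (a + 1) ^ 2 ≤ 2 ^ (r / 2)) (ht₁ : 3 * s₀ < 2 ^ (t₁ + 1)) (hΛ : 64 * (a + 1) ^ 2 ≤ Nat.sqrt s₀)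
    (hC : 3 * 2 ^ a < D₀ * 3 ^ (C + 1))
    (hB : 3 * 2 ^ a * (64 * (a + 1) ^ 2) ^ (B + 1) < D₀ * Nat.sqrt s₀ ^ (B + 1))
    (hdepth : 2 ^ B * (dmin + C * t₁) ≤ a) (hD₀ : 2 ^ (a - dmin + 1) ≤ D₀) (hdmin : dmin ≤ a)
    {p : Bool → Fin n} {S : Finset (List (Fin 3))} (hI : Inv μ F r p a S) (hS : D₀ ≤ S.card) : False :=
  no_level hμ hF hs₀ hdense hr ht₁ hΛ hC hB hdepth hD₀ hdmin (B + C + 1) 0 0 p a S hI le_rfl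
    (by simpa using hS) (by simp) (by simp)

end Main

end CleanPair

open CleanPair in
/-- **`stub_noStartLevel`** (registered sub-goal of stmt-MatrixMultiplication-10883): no totally dirty, separated, `F`-avoiding single-cell
family of `≥ D₀` reduced words of length `a` exists under the scale conditions (ATOM_PROOF §5). -/
theorem stub_noStartLevel : ∀ (n r s₀ a B C dmin t₁ D₀ : ℕ) (μ : Fin 3 → Equiv.Perm (Fin n)) (F : Finset (Fin n)) (p : Bool → Fin n) (S : Finset (List (Fin 3))), (∀ c, μ c * μ c = 1) → Summit.MatrixMultiplication.MatrixMultiplication.Theorems.HyperoctahedralThreshold.CleanPair.NoShortCycleOutside μ F r → 0 < s₀ → (∀ y ∉ F, ∀ m, 1 ≤ m → m ≤ 2 * a → s₀ * (Summit.MatrixMultiplication.MatrixMultiplication.Theorems.HyperoctahedralThreshold.TwinSupplyCS.closedAt μ m y).card ≤ 2 ^ m) → 288 * (a + 1) ^ 2 ≤ 2 ^ (r / 2) → 3 * s₀ < 2 ^ (t₁ + 1) → 64 * (a + 1) ^ 2 ≤ Nat.sqrt s₀ → 3 * 2 ^ a < D₀ * 3 ^ (C + 1) → 3 * 2 ^ a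 * (64 * (a + 1) ^ 2) ^ (B + 1) < D₀ * Nat.sqrt s₀ ^ (B + 1) → 2 ^ B * (dmin + C * t₁) ≤ a → 2 ^ (a - dmin + 1) ≤ D₀ → dmin ≤ a → Summit.MatrixMultiplication.MatrixMultiplication.Theorems.HyperoctahedralThreshold.CleanPair.Inv μ F r p a S → D₀ ≤ S.card → False :=
  fun _ _ _ _ _ _ _ _ _ _ _ _ _ hμ hF hs₀ hdense hr ht₁ hΛ hC hB hdepth hD₀ hdmin hI hS =>
    no_start_level hμ hF hs₀ hdense hr ht₁ hΛ hC hB hdepth hD₀ hdmin hI hS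

end Summit.MatrixMultiplication.MatrixMultiplication.Theorems.HyperoctahedralThreshold
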